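import Literature.Analysis.OperatorTheory.Enflo2023.CaseIIMoves
import HarnessLib

/-!
# Enflo (2023), Part A p.13: the factor `(1 − 1/20)` for THE minimal solution of (26) — a two-sided law

Source under adjudication: Per H. Enflo, *On the invariant subspace problem in Hilbert spaces*, arXiv:2305.15442
(v2, 2024), bib key `Enflo2023`.  [cite: Enflo2023, v2 p.13, tex L421–L431: "Equation (27) gives
`⟨ℓ'(T)y₁', x₀ − ℓ'(T)y₁'⟩ < εθ(1 − 1/20)` … or we get Case II and pass to a smaller `εθ`, diminished by a factor
`(1 − 1/20)`, and not moving more than `(εθ)²` by (27)."]  Part of the b2b-enflo repair cell's kernel-tight typing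
of the manuscript (formaliser 1, Part A).  NOTHING here asserts the manuscript's main theorem; no declaration
concludes the invariant subspace problem for an arbitrary operator.  Value (BLOCK-2b): theorems / refutations of
typed inferences about a text.

`CaseIIMoves.lean` showed that on the all-Case-II branch the factor (indeed any uniform contraction `r < 1` of
`εθ`) is the ONLY thing the convergence argument consumes, and `CaseII.lean` / `CaseIIMinimal.lean` / `CaseIIT.lean`
that (27), the text's reason for the factor, is false.  Here the factor itself is COMPUTED for THE minimal solution
`a` of (26) (`IsMinimal V_y x₀ ‖x₀ − (1+δ)y‖ a`, `δ = εθ/10`) under Case II taken exactly (`⟨x₀ − y, T^j y⟩ = 0`,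
`j ≥ 1`) and `⟨x₀ − y, y⟩ = εθ`:

* STRUCTURE (`CaseII.re_inner_displacement_law`): with `w := ℓ'(T)y − y`, `κ := ⟨y, Ty⟩`, `σ := ‖Ty‖` and `C ≥ 0`
  the multiplier of (4)–(5): `|Re⟨y, w⟩ − (Re a₀ − 1)·S_C| ≤ 2‖y‖·‖T²V_y(L²a)‖` where
  `S_C := ‖y‖² − |κ|²/(C + σ²)` is the `e₀`-Schur complement of `C + Gram(y, Ty)`: the Lagrange conditions at the
  coordinates `0, 1` force `a₁ = −(a₀ − 1)κ̄/(C + σ²) + tail`, and this coefficient CANCELS the fraction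
  `|κ|²/((C + σ²)‖y‖²)` of the displacement along `y` — the only part of the move that lowers `εθ`
  (`CaseII.mul_re_head_eq_sub`: `C·Re a₀ = εθ − Re⟨y, w⟩`).
* THE LAW (`CaseII.etheta_succ_law`): for `‖T‖ ≤ 10⁻²⁰`, `‖x₀‖ = 1`, `‖x₀ − y‖ ≤ 0.7`, `10⁻⁷⁸ ≤ εθ ≤ 10⁻⁴`,
  writing `(εθ)' := Re⟨x₀ − ℓ'(T)y, ℓ'(T)y⟩` (the `εθ` of the next stage, `= C‖ℓ'‖₂²` by (6)):
      `εθ·(1 − S⁺/10) − 10⁻⁴⁰√εθ ≤ (εθ)' ≤ (1+δ)²·εθ·(1 − (19/200)·S₀) + 10⁻⁴⁰√εθ`,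
  `S⁺ := ‖y‖² − |κ|²/(1.1εθ + σ²)`, `S₀ := ‖y‖² − |κ|²/σ² = ‖y‖² sin²∠(y, Ty)` (`0 ≤ S₀ ≤ S_C ≤ S⁺ ≤ ‖y‖²`).
  In the text's regime `εθ ≫ σ²` this is the factor `≈ 1 − ‖y‖²/10 ≤ 1 − 1/20`; deep in a run (`εθ ≪ σ²`) it is
  `1 − Θ(‖y‖² sin²∠(y,Ty))/10`, i.e. governed by the ANGLE between `y` and `Ty`, not by `1/20`.
* VERDICT ON THE SENTENCE (`CaseII.factor_false_for_minimal`, `CaseII.not_factor_for_minimal`): if moreover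
  `|⟨y,Ty⟩|² ≥ (‖y‖² − 0.49)(1.1εθ + ‖Ty‖²)` and `εθ ≥ 10⁻⁷⁰`, then `(εθ)' > (1 − 1/20)εθ` — "pass to a smaller
  `εθ`, diminished by a factor `(1 − 1/20)`" FAILS for the actual minimal move; conversely
  `CaseII.factor_of_large_angle`: it HOLDS whenever `‖y‖² − |⟨y,Ty⟩|²/‖Ty‖² ≥ 3/5`.  Non-vacuity with a genuine
  operator and its genuine minimiser: `CaseII.FactorModel.*` (data `yF, wF, x0F, TF, etF`) and
  `CaseII.factor_false_satisfiable` (in `ℂ³`: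
  `y = (5/7)e₀`, `Ty = 10⁻²¹(e₀ + e₁)`, `T` of rank one with `‖T‖ ≤ 10⁻²⁰`, `εθ = 10⁻⁵⁰`, `⟨x₀ − y, y⟩ = εθ` and
  `⟨x₀ − y, T^j y⟩ = 0` for all `j ≥ 1` EXACTLY, `‖x₀‖ = 1`, `‖x₀ − y‖² = 24/49 − 2εθ`).

So neither (27) nor the factor it was to deliver holds for the minimal solution of (26) in general; what does hold
is the two-sided law above, whose infimum along a run is exactly the open point recorded in `CaseIIMoves.lean`
(`hasNontrivialClosedInvariantSubspace_of_contraction_along_runs` stays conditional).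
Origin: planner-b2b-enflo-1-g6-0 (F1 gen-6), 2026-08-18.
-/

noncomputable section

open scoped InnerProductSpace
open Literature.Analysis.UnboundedOperators (inner_self_eq_coe_norm_sq)

namespace Literature.Analysis.OperatorTheory.Enflo2023

section General

variable {H : Type*} [NormedAddCommGroup H] [InnerProductSpace ℂ H] [CompleteSpace H]

namespace CaseII

open Vy

/-! ### The Schur-complement structure of the displacement along `y` -/

/-- **Structure of the minimal move under exact Case II at `j = 1`.**  Let `C ≥ 0` be the multiplier of (4)–(5)
for `a` (any Lagrange point of (26) over `V_y`), `w := V_y a − y` the displacement, `κ := ⟨y, Ty⟩`, `σ := ‖Ty‖`,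
and suppose `⟨x₀ − y, Ty⟩ = 0`.  Then
`|Re⟨y, w⟩ − (Re a₀ − 1)·(‖y‖² − |κ|²/(C + σ²))| ≤ 2‖y‖·‖T²V_y(L²a)‖`:
the coordinate-1 Lagrange condition `C a₁ = −⟨Ty, w⟩` solves to `a₁(C + σ²) = −(a₀ − 1)κ̄ − ⟨Ty, tail⟩`, and
substituting into `⟨y, w⟩ = (a₀ − 1)‖y‖² + a₁κ + ⟨y, tail⟩` leaves the `e₀`-Schur complement
`S_C = ‖y‖² − |κ|²/(C + σ²)` of `C + Gram(y, Ty)` as the effective progress per unit of `a₀ − 1`.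
[cite: Enflo2023, v2 p.13, eq. (26); v2 p.4, eq. (4)–(5)] -/
theorem re_inner_displacement_law (T : H →L[ℂ] H) (hT : ‖T‖ < 1) (x₀ y : H) (a : ℓ2) {C : ℝ}
    (hC0 : 0 ≤ C) (hC : ContinuousLinearMap.adjoint (V T hT y) (x₀ - V T hT y a) = (C : ℂ) • a)
    (hII : ⟪x₀ - y, T y⟫_ℂ = 0) :
    |(⟪y, V T hT y a - y⟫_ℂ).re - ((a 0).re - 1) * (‖y‖ ^ 2 - ‖⟪y, T y⟫_ℂ‖ ^ 2 / (C + ‖T y‖ ^ 2))|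
      ≤ 2 * ‖y‖ * ‖T (T (V T hT y (L (L a))))‖ := by
  set w := V T hT y a - y with hw_def
  set t₂ := T (T (V T hT y (L (L a)))) with ht₂_def
  set κ := ⟪y, T y⟫_ℂ with hκ_def
  have hdec : V T hT y a = a 0 • y + a 1 • T y + t₂ := V_decomp₂ T hT y a
  have hw : w = (a 0 - 1) • y + a 1 • T y + t₂ := by
    rw [hw_def, hdec, sub_smul, one_smul]; abel
  have hyy : ⟪y, y⟫_ℂ = ((‖y‖ ^ 2 : ℝ) : ℂ) := inner_self_eq_coe_norm_sq y
  have hTT : ⟪T y, T y⟫_ℂ = ((‖T y‖ ^ 2 : ℝ) : ℂ) := inner_self_eq_coe_norm_sq (T y)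
  have hTy : ⟪T y, y⟫_ℂ = (starRingEnd ℂ) κ := by rw [hκ_def, inner_conj_symm]
  -- the two expansions of the displacement
  have E0 : ⟪y, w⟫_ℂ = (a 0 - 1) * ((‖y‖ ^ 2 : ℝ) : ℂ) + a 1 * κ + ⟪y, t₂⟫_ℂ := by
    rw [hw, inner_add_right, inner_add_right, inner_smul_right, inner_smul_right, hyy]
  have E1 : ⟪T y, w⟫_ℂ = (a 0 - 1) * (starRingEnd ℂ) κ + a 1 * ((‖T y‖ ^ 2 : ℝ) : ℂ) + ⟪T y, t₂⟫_ℂ := by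
    rw [hw, inner_add_right, inner_add_right, inner_smul_right, inner_smul_right, hTy, hTT]
  -- Lagrange coordinate 1 under exact Case II: `C a₁ = −⟨Ty, w⟩`
  have h1 : (C : ℂ) * a 1 = -⟪T y, w⟫_ℂ := by
    have h := kkt_coeff_of_orthogonal T hT x₀ y a hC (j := 1)
      (by rw [pow_one]; exact inner_eq_zero_symm.1 hII)
    simpa only [pow_one] using h
  have E2 : ((C : ℂ) + ((‖T y‖ ^ 2 : ℝ) : ℂ)) * a 1 = -((a 0 - 1) * (starRingEnd ℂ) κ) - ⟪T y, t₂⟫_ℂ := by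
    linear_combination h1 - E1
  have hκκ : κ * (starRingEnd ℂ) κ = ((‖κ‖ ^ 2 : ℝ) : ℂ) := by
    rw [Complex.mul_conj, Complex.normSq_eq_norm_sq]
  have Key : ((C + ‖T y‖ ^ 2 : ℝ) : ℂ) * ⟪y, w⟫_ℂ
      - (a 0 - 1) * ((‖y‖ ^ 2 * (C + ‖T y‖ ^ 2) - ‖κ‖ ^ 2 : ℝ) : ℂ)
      = -(κ * ⟪T y, t₂⟫_ℂ) + ((C + ‖T y‖ ^ 2 : ℝ) : ℂ) * ⟪y, t₂⟫_ℂ := by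
    push_cast at E0 E2 hκκ ⊢
    linear_combination ((C : ℂ) + (‖T y‖ : ℂ) ^ 2) * E0 + κ * E2 - (a 0 - 1) * hκκ
  have hre1 : ∀ r : ℝ, ((a 0 - 1) * (r : ℂ)).re = ((a 0).re - 1) * r := by
    intro r; simp [Complex.mul_re]
  have hK := congrArg Complex.re Key
  rw [Complex.sub_re, Complex.re_ofReal_mul, hre1] at hK
  -- the right-hand side is a tail term
  have hR : |(-(κ * ⟪T y, t₂⟫_ℂ) + ((C + ‖T y‖ ^ 2 : ℝ) : ℂ) * ⟪y, t₂⟫_ℂ).re|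
      ≤ (C + ‖T y‖ ^ 2) * (2 * ‖y‖ * ‖t₂‖) := by
    refine (Complex.abs_re_le_norm _).trans ((norm_add_le _ _).trans ?_)
    rw [norm_neg, norm_mul, norm_mul, Complex.norm_real, Real.norm_of_nonneg (by positivity)]
    have hκle : ‖κ‖ ≤ ‖y‖ * ‖T y‖ := norm_inner_le_norm y (T y)
    have h1' : ‖⟪T y, t₂⟫_ℂ‖ ≤ ‖T y‖ * ‖t₂‖ := norm_inner_le_norm _ _
    have h2' : ‖⟪y, t₂⟫_ℂ‖ ≤ ‖y‖ * ‖t₂‖ := norm_inner_le_norm _ _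
    have hs2C : ‖T y‖ ^ 2 ≤ C + ‖T y‖ ^ 2 := by linarith
    have hyt : 0 ≤ ‖y‖ * ‖t₂‖ := by positivity
    calc ‖κ‖ * ‖⟪T y, t₂⟫_ℂ‖ + (C + ‖T y‖ ^ 2) * ‖⟪y, t₂⟫_ℂ‖
        ≤ (‖y‖ * ‖T y‖) * (‖T y‖ * ‖t₂‖) + (C + ‖T y‖ ^ 2) * (‖y‖ * ‖t₂‖) := by
          gcongr
      _ = ‖T y‖ ^ 2 * (‖y‖ * ‖t₂‖) + (C + ‖T y‖ ^ 2) * (‖y‖ * ‖t₂‖) := by ring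
      _ ≤ (C + ‖T y‖ ^ 2) * (‖y‖ * ‖t₂‖) + (C + ‖T y‖ ^ 2) * (‖y‖ * ‖t₂‖) := by gcongr
      _ = (C + ‖T y‖ ^ 2) * (2 * ‖y‖ * ‖t₂‖) := by ring
  by_cases hD : 0 < C + ‖T y‖ ^ 2
  · have hX : (⟪y, w⟫_ℂ).re - ((a 0).re - 1) * (‖y‖ ^ 2 - ‖κ‖ ^ 2 / (C + ‖T y‖ ^ 2))
        = ((C + ‖T y‖ ^ 2) * (⟪y, w⟫_ℂ).re
            - ((a 0).re - 1) * (‖y‖ ^ 2 * (C + ‖T y‖ ^ 2) - ‖κ‖ ^ 2)) / (C + ‖T y‖ ^ 2) := by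
      field_simp
    rw [hX, hK, abs_div, abs_of_pos hD, div_le_iff₀ hD]
    calc _ ≤ (C + ‖T y‖ ^ 2) * (2 * ‖y‖ * ‖t₂‖) := hR
      _ = 2 * ‖y‖ * ‖t₂‖ * (C + ‖T y‖ ^ 2) := by ring
  · -- `C = 0` and `Ty = 0`: then `κ = 0` and `S_C = ‖y‖²`
    have hs2 : ‖T y‖ ^ 2 = 0 := by nlinarith [sq_nonneg ‖T y‖]
    have hTy0 : ‖T y‖ = 0 := pow_eq_zero_iff two_ne_zero |>.1 hs2
    have hκ0 : κ = 0 := by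
      rw [hκ_def, ← norm_eq_zero]
      apply le_antisymm _ (norm_nonneg _)
      calc ‖⟪y, T y⟫_ℂ‖ ≤ ‖y‖ * ‖T y‖ := norm_inner_le_norm _ _
        _ = 0 := by rw [hTy0, mul_zero]
    have hE0re := congrArg Complex.re E0
    rw [hκ0, mul_zero, add_zero, Complex.add_re, hre1] at hE0re
    rw [hκ0, norm_zero, hs2, zero_pow two_ne_zero, zero_div, sub_zero, hE0re, add_sub_cancel_left]
    calc |(⟪y, t₂⟫_ℂ).re| ≤ ‖⟪y, t₂⟫_ℂ‖ := Complex.abs_re_le_norm _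
      _ ≤ ‖y‖ * ‖t₂‖ := norm_inner_le_norm _ _
      _ ≤ 2 * ‖y‖ * ‖t₂‖ := by nlinarith [norm_nonneg y, norm_nonneg t₂]

/-! ### The two-sided law for `(εθ)'` of THE minimal solution of (26) -/

/-- Preliminaries of the factor law (real arithmetic): the active constraint gives `u ≥ 1 + (19/200)εθ`,
`A ≤ √εθ/9`, hence the tail is `≤ 10⁻⁴⁰√εθ/3`. [cite: Enflo2023, v2 p.13, eq. (26)] -/
lemma law_prelims {et u A na Y r E : ℝ}
    (het0 : 1 / 10 ^ 78 ≤ et) (het1 : et ≤ 1 / 10 ^ 4) (hr0 : 0 ≤ r) (hr2 : r ^ 2 = et)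
    (hYle : Y ≤ 1) (hA0 : 0 ≤ A)
    (hu : u ≤ 1 + et / 10) (hsplit : u ^ 2 + A ^ 2 ≤ na) (hna : na ≤ (1 + et / 10) ^ 2)
    (hw0 : 0 ≤ (et / 10) ^ 2 * Y - 2 * et * ((1 + et / 10) - u)) (hE : E ≤ 3 / 10 ^ 40 * A) :
    1 ≤ u ∧ 1 + 19 / 200 * et ≤ u ∧ E ≤ 1 / 10 ^ 40 / 3 * r ∧ 1 / 10 ^ 39 * r ≤ et := by
  have hpos : 0 < et := lt_of_lt_of_le (by norm_num) het0
  have hr39 : 1 / 10 ^ 39 ≤ r :=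
    (pow_le_pow_iff_left₀ (by norm_num) hr0 two_ne_zero).1 (by rw [hr2]; exact le_trans (by norm_num) het0)
  have hrr : 1 / 10 ^ 39 * r ≤ et := by rw [← hr2, sq]; exact mul_le_mul_of_nonneg_right hr39 hr0
  have hu_lo : 1 + et / 10 - et * Y / 200 ≤ u := by
    have h2 : et * (2 * (1 + et / 10 - u)) ≤ et * (et * Y / 100) := by linarith [hw0]
    have h3 : 2 * (1 + et / 10 - u) ≤ et * Y / 100 := le_of_mul_le_mul_left h2 hpos
    linarith
  have hetY : et * Y ≤ et := mul_le_of_le_one_right hpos.le hYle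
  have hu1 : 1 ≤ u := by linarith
  have hu19 : 1 + 19 / 200 * et ≤ u := by linarith
  have hgap : 1 + et / 10 - u ≤ et / 200 := by linarith
  have hA2 : A ^ 2 ≤ et / 99 := by
    have h1 : A ^ 2 ≤ (1 + et / 10) ^ 2 - u ^ 2 := by linarith
    have h3 : (1 + et / 10 - u) * (1 + et / 10 + u) ≤ (et / 200) * (201 / 100) :=
      mul_le_mul hgap (by linarith) (by linarith) (by positivity)
    linarith
  have hAr : A ≤ r / 9 := by
    have h : A ^ 2 ≤ (r / 9) ^ 2 := by rw [div_pow, hr2]; linarith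
    exact (pow_le_pow_iff_left₀ hA0 (by positivity) two_ne_zero).1 h
  have hE' : E ≤ 1 / 10 ^ 40 / 3 * r := by
    have := mul_le_mul_of_nonneg_left hAr (by norm_num : (0 : ℝ) ≤ 3 / 10 ^ 40)
    linarith
  exact ⟨hu1, hu19, hE', hrr⟩

/-- The Schur complements `S_C = Y − k²/(C + σ²)`: `0 ≤ S_C ≤ Y` (Cauchy–Schwarz `k² ≤ Yσ²`). [folklore] -/
lemma law_schur_nonneg {C Y k2 s2 : ℝ} (hY0 : 0 ≤ Y) (hC0 : 0 ≤ C) (hk0 : 0 ≤ k2) (hs0 : 0 ≤ s2)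
    (hk : k2 ≤ Y * s2) : 0 ≤ Y - k2 / (C + s2) ∧ Y - k2 / (C + s2) ≤ Y := by
  refine ⟨?_, ?_⟩
  · rw [sub_nonneg]
    rcases eq_or_lt_of_le (add_nonneg hC0 hs0) with h | h
    · rw [← h, div_zero]; exact hY0
    · rw [div_le_iff₀ h]; linarith [mul_nonneg hY0 hC0]
  · have : 0 ≤ k2 / (C + s2) := div_nonneg hk0 (add_nonneg hC0 hs0)
    linarith

/-- Monotonicity of the Schur complements in the multiplier: `S₀ ≤ S_C ≤ S⁺` for `0 ≤ C ≤ 1.1εθ`, and `0 ≤ S₀`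
(with the junk value `k²/0 = 0` when `σ = 0`, which forces `k = 0`). [folklore] -/
lemma law_schur_mono {et C Y k2 s2 : ℝ} (hY0 : 0 ≤ Y) (hC0 : 0 ≤ C) (hk0 : 0 ≤ k2)
    (hs0 : 0 ≤ s2) (hk : k2 ≤ Y * s2) (hC1 : C ≤ 11 / 10 * et) :
    Y - k2 / (C + s2) ≤ Y - k2 / (11 / 10 * et + s2) ∧ Y - k2 / s2 ≤ Y - k2 / (C + s2) ∧
      0 ≤ Y - k2 / s2 := by
  have hs2pos : 0 < k2 → 0 < s2 := fun h => by
    by_contra hneg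
    have hz : s2 = 0 := le_antisymm (not_lt.1 hneg) hs0
    rw [hz, mul_zero] at hk
    linarith
  refine ⟨?_, ?_, ?_⟩
  · rcases eq_or_lt_of_le hk0 with h | h
    · rw [← h, zero_div, zero_div]
    · have hle : k2 / (11 / 10 * et + s2) ≤ k2 / (C + s2) :=
        div_le_div_of_nonneg_left hk0 (by linarith [hs2pos h]) (by linarith)
      linarith
  · rcases eq_or_lt_of_le hk0 with h | h
    · rw [← h, zero_div, zero_div]
    · have hle : k2 / (C + s2) ≤ k2 / s2 := div_le_div_of_nonneg_left hk0 (hs2pos h) (by linarith)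
      linarith
  · rw [sub_nonneg]
    rcases eq_or_lt_of_le hs0 with h | h
    · rw [← h, div_zero]; exact hY0
    · rw [div_le_iff₀ h]; linarith

/-- The real arithmetic of `etheta_succ_law`, isolated: from the budget `u ≤ 1+δ`, `u² + A² ≤ ‖a‖² ≤ (1+δ)²`,
(6) `(εθ)' = C‖a‖²`, the active constraint (`hw0`: `‖V_y a − y‖² ≥ 0` in the form of
`norm_sq_displacement_eq`), the coordinate-0 equation `C·u = εθ − R`, the Schur law `|R − (u−1)S_C| ≤ E` and the
tail bound `E ≤ 3·10⁻⁴⁰A`, conclude the two-sided law. [cite: Enflo2023, v2 p.13, tex L421–L431] -/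
theorem etheta_succ_law_arith {et u A na C Y k2 s2 R E r ep : ℝ}
    (het0 : 1 / 10 ^ 78 ≤ et) (het1 : et ≤ 1 / 10 ^ 4) (hr0 : 0 ≤ r) (hr2 : r ^ 2 = et)
    (hY0 : 0 ≤ Y) (hYle : Y ≤ 1) (hC0 : 0 ≤ C) (hA0 : 0 ≤ A) (hk0 : 0 ≤ k2) (hs0 : 0 ≤ s2)
    (hk : k2 ≤ Y * s2)
    (hu : u ≤ 1 + et / 10) (hsplit : u ^ 2 + A ^ 2 ≤ na) (hna : na ≤ (1 + et / 10) ^ 2)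
    (hep : ep = C * na) (hw0 : 0 ≤ (et / 10) ^ 2 * Y - 2 * et * ((1 + et / 10) - u))
    (hCu : C * u = et - R) (hlaw : |R - (u - 1) * (Y - k2 / (C + s2))| ≤ E)
    (hE : E ≤ 3 / 10 ^ 40 * A) :
    et * (1 - (Y - k2 / (11 / 10 * et + s2)) / 10) - 1 / 10 ^ 40 * r ≤ ep ∧
      ep ≤ (1 + et / 10) ^ 2 * et * (1 - 19 / 200 * (Y - k2 / s2)) + 1 / 10 ^ 40 * r := by
  have hpos : 0 < et := lt_of_lt_of_le (by norm_num) het0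
  obtain ⟨hu1, hu19, hE', hrr⟩ := law_prelims het0 het1 hr0 hr2 hYle hA0 hu hsplit hna hw0 hE
  obtain ⟨hSC0, hSCY⟩ := law_schur_nonneg (C := C) hY0 hC0 hk0 hs0 hk
  set SC := Y - k2 / (C + s2) with hSC_def
  obtain ⟨hlo, hhi⟩ := abs_le.1 (hlaw.trans hE')
  -- a priori `C ≤ 1.1 εθ`
  have hCle : C ≤ C * u := le_mul_of_one_le_right hC0 hu1
  have hC1 : C ≤ 11 / 10 * et := by
    have h2 : 0 ≤ (u - 1) * SC := mul_nonneg (by linarith) hSC0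
    linarith
  obtain ⟨hSplus, hS0, hS00⟩ := law_schur_mono hY0 hC0 hk0 hs0 hk hC1
  have hetr : et * r ≤ 1 / 10 ^ 4 * r := mul_le_mul_of_nonneg_right het1 hr0
  refine ⟨?_, ?_⟩
  · -- LOWER: ep = C‖a‖² ≥ C u² = u (εθ − R) ≥ u (εθ − (u−1)S_C − E) ≥ εθ − δ S_C − (1+δ)E
    have h1 : C * u ^ 2 ≤ ep := by
      rw [hep]; linarith [mul_le_mul_of_nonneg_left hsplit hC0, mul_nonneg hC0 (sq_nonneg A)]
    have h2 : u * (et - ((u - 1) * SC + 1 / 10 ^ 40 / 3 * r)) ≤ C * u ^ 2 := by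
      have : C * u ^ 2 = u * (C * u) := by ring
      rw [this, hCu]
      exact mul_le_mul_of_nonneg_left (by linarith) (by linarith)
    have h3 : et - et / 10 * SC - (1 + et / 10) * (1 / 10 ^ 40 / 3 * r)
        ≤ u * (et - ((u - 1) * SC + 1 / 10 ^ 40 / 3 * r)) := by
      have hd0 : 0 ≤ u - 1 := by linarith
      have hSC1 : SC ≤ 1 := hSCY.trans hYle
      have p1 : 0 ≤ (u - 1) * (et - (u - 1)) := mul_nonneg hd0 (by linarith)
      have p2 : 0 ≤ (et / 10 - (u - 1)) * SC := mul_nonneg (by linarith) hSC0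
      have p3 : 0 ≤ (et / 10 - (u - 1)) * (1 / 10 ^ 40 / 3 * r) := mul_nonneg (by linarith) (by positivity)
      have p4 : 0 ≤ (1 - SC) * (u - 1) ^ 2 := mul_nonneg (by linarith) (sq_nonneg _)
      linarith [p1, p2, p3, p4]
    have h4 : et * (1 - (Y - k2 / (11 / 10 * et + s2)) / 10) - 1 / 10 ^ 40 * r
        ≤ et - et / 10 * SC - (1 + et / 10) * (1 / 10 ^ 40 / 3 * r) := by
      have := mul_le_mul_of_nonneg_left hSplus (by positivity : (0 : ℝ) ≤ et / 10)
      linarith [hetr, hr0]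
    exact h4.trans (h3.trans (h2.trans h1))
  · -- UPPER: ep = C‖a‖² ≤ C(1+δ)²; C ≤ C u = εθ − R ≤ εθ − (u−1)S_C + E ≤ εθ − (19/200)εθ·S₀ + E
    have h1 : ep ≤ C * (1 + et / 10) ^ 2 := by rw [hep]; exact mul_le_mul_of_nonneg_left hna hC0
    have h3 : 19 / 200 * et * (Y - k2 / s2) ≤ (u - 1) * SC :=
      mul_le_mul (by linarith) hS0 hS00 (by linarith)
    have h4 : C ≤ et - 19 / 200 * et * (Y - k2 / s2) + 1 / 10 ^ 40 / 3 * r := by linarith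
    have h5 : ep ≤ (et - 19 / 200 * et * (Y - k2 / s2) + 1 / 10 ^ 40 / 3 * r) * (1 + et / 10) ^ 2 :=
      h1.trans (mul_le_mul_of_nonneg_right h4 (by positivity))
    have h6 : (1 + et / 10) ^ 2 ≤ 101 / 100 := by linarith [mul_le_mul_of_nonneg_left het1 hpos.le]
    have h7 : 1 / 10 ^ 40 / 3 * r * (1 + et / 10) ^ 2 ≤ 1 / 10 ^ 40 / 3 * r * (101 / 100) :=
      mul_le_mul_of_nonneg_left h6 (by positivity)
    have h8 : (et - 19 / 200 * et * (Y - k2 / s2) + 1 / 10 ^ 40 / 3 * r) * (1 + et / 10) ^ 2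
        = (1 + et / 10) ^ 2 * et * (1 - 19 / 200 * (Y - k2 / s2))
          + 1 / 10 ^ 40 / 3 * r * (1 + et / 10) ^ 2 := by
      ring
    linarith

/-- **The factor law.**  For `‖T‖ ≤ 10⁻²⁰`, `‖x₀‖ = 1`, `⟨x₀ − y, y⟩ = εθ` with `10⁻⁷⁸ ≤ εθ ≤ 10⁻⁴`,
`‖x₀ − y‖ ≤ 0.7`, Case II exact (`⟨x₀ − y, T^j y⟩ = 0`, `j ≥ 1`) and `a` THE minimal solution of (26)
(`ε' = ‖x₀ − (1 + εθ/10)y‖`), the `εθ` of the next stage `(εθ)' = Re⟨x₀ − ℓ'(T)y, ℓ'(T)y⟩` obeys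
`εθ(1 − S⁺/10) − 10⁻⁴⁰√εθ ≤ (εθ)' ≤ (1 + εθ/10)²·εθ·(1 − (19/200)S₀) + 10⁻⁴⁰√εθ` with
`S⁺ = ‖y‖² − |⟨y,Ty⟩|²/(1.1εθ + ‖Ty‖²)` and `S₀ = ‖y‖² − |⟨y,Ty⟩|²/‖Ty‖²`.  Ingredients: (6) `(εθ)' = C‖a‖²`,
`C·Re a₀ = εθ − Re⟨y, w⟩` (coordinate 0, `mul_re_head_eq_sub`), the Schur law `re_inner_displacement_law`
(coordinate 1), the ACTIVE constraint (`norm_sq_displacement_eq`: `Re a₀ ≥ 1 + δ − δ‖y‖²/20`, `‖La‖² ≤ εθ/99`),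
the budget `‖a‖ ≤ 1 + δ` (`minimal_facts`), the a-priori bound `C ≤ 1.1εθ`, and the tail
`‖T²V_y L²a‖ ≤ 10⁻⁴⁰·1.0001·‖La‖` (`norm_tail₂_le`).  In the text's regime `εθ ≫ ‖Ty‖²` both sides read
`(εθ)' ≈ εθ(1 − ‖y‖²/10)`; for `εθ ≪ ‖Ty‖²` the factor is `1 − Θ(‖y‖² sin²∠(y,Ty))/10`.
[cite: Enflo2023, v2 p.13, tex L421–L431; eq. (6), (26)] -/
theorem etheta_succ_law (T : H →L[ℂ] H) (hT1 : ‖T‖ < 1) (hT : ‖T‖ ≤ 1 / 10 ^ 20)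
    (x₀ y : H) (et : ℝ) (a : ℓ2)
    (h0 : ‖x₀‖ = 1) (ht : ⟪x₀ - y, y⟫_ℂ = et) (het0 : 1 / 10 ^ 78 ≤ et) (het1 : et ≤ 1 / 10 ^ 4)
    (hd : ‖x₀ - y‖ ≤ 0.7) (hII : ∀ j, 1 ≤ j → ⟪x₀ - y, (T ^ j) y⟫_ℂ = 0)
    (hmin : IsMinimal (V T hT1 y) x₀ ‖x₀ - ((1 + et / 10 : ℝ) : ℂ) • y‖ a) :
    et * (1 - (‖y‖ ^ 2 - ‖⟪y, T y⟫_ℂ‖ ^ 2 / (11 / 10 * et + ‖T y‖ ^ 2)) / 10) - 1 / 10 ^ 40 * Real.sqrt et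
        ≤ (⟪x₀ - V T hT1 y a, V T hT1 y a⟫_ℂ).re ∧
      (⟪x₀ - V T hT1 y a, V T hT1 y a⟫_ℂ).re
        ≤ (1 + et / 10) ^ 2 * et * (1 - 19 / 200 * (‖y‖ ^ 2 - ‖⟪y, T y⟫_ℂ‖ ^ 2 / ‖T y‖ ^ 2))
          + 1 / 10 ^ 40 * Real.sqrt et := by
  have het0' : 0 ≤ et := le_trans (by norm_num) het0
  have htre : (⟪x₀ - y, y⟫_ℂ).re = et := by rw [ht, Complex.ofReal_re]
  obtain ⟨hy1, -, -, -, hrad1⟩ := setting x₀ y et h0 htre het0' het1 hd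
  have ha0 : a ≠ 0 := hmin.ne_zero hrad1
  obtain ⟨C, hC0, hC⟩ := hmin.kkt ha0
  obtain ⟨-, -, -, hu, hsplit, hna, -, hep⟩ := minimal_facts T hT1 hT x₀ y et a h0 htre het0' het1 hd hmin hC
  have hact : ‖x₀ - V T hT1 y a‖ = ‖x₀ - ((1 + et / 10 : ℝ) : ℂ) • y‖ := hmin.norm_sub_eq hrad1
  have hw0 : 0 ≤ (et / 10) ^ 2 * ‖y‖ ^ 2 - 2 * et * ((1 + et / 10) - (a 0).re) := by
    rw [← norm_sq_displacement_eq T hT1 x₀ y et a ht hII hact]; positivity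
  have hCu : C * (a 0).re = et - (⟪y, V T hT1 y a - y⟫_ℂ).re := mul_re_head_eq_sub T hT1 x₀ y et a htre hC
  have hII1 : ⟪x₀ - y, T y⟫_ℂ = 0 := by simpa using hII 1 le_rfl
  have hlaw := re_inner_displacement_law T hT1 x₀ y a hC0 hC hII1
  -- the tail: `2‖y‖‖T²V_y L²a‖ ≤ 3·10⁻⁴⁰‖La‖`
  have hys : ‖y‖ * Real.sqrt (1 / (1 - ‖T‖ ^ 2)) ≤ 1 + 1 / 10 ^ 4 := norm_y_mul_sqrt_le hT hy1
  have hq2 : ‖T‖ ^ 2 ≤ 1 / 10 ^ 40 := (pow_le_pow_left₀ (norm_nonneg _) hT 2).trans (by norm_num)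
  have ht₂ : ‖T (T (V T hT1 y (L (L a))))‖ ≤ 1 / 10 ^ 40 * (1 + 1 / 10 ^ 4) * ‖L a‖ :=
    (norm_tail₂_le T hT1 y a).trans
      (mul_le_mul_of_nonneg_right (mul_le_mul hq2 hys (by positivity) (by norm_num)) (norm_nonneg _))
  have hE : 2 * ‖y‖ * ‖T (T (V T hT1 y (L (L a))))‖ ≤ 3 / 10 ^ 40 * ‖L a‖ := by
    have h2 : 2 * ‖y‖ * ‖T (T (V T hT1 y (L (L a))))‖ ≤ 2 * 1 * (1 / 10 ^ 40 * (1 + 1 / 10 ^ 4) * ‖L a‖) :=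
      mul_le_mul (by linarith) ht₂ (norm_nonneg _) (by norm_num)
    linarith [norm_nonneg (L a)]
  -- Cauchy–Schwarz
  have hk : ‖⟪y, T y⟫_ℂ‖ ^ 2 ≤ ‖y‖ ^ 2 * ‖T y‖ ^ 2 := by
    rw [← mul_pow]; exact pow_le_pow_left₀ (norm_nonneg _) (norm_inner_le_norm y (T y)) 2
  exact etheta_succ_law_arith het0 het1 (Real.sqrt_nonneg et) (Real.sq_sqrt het0') (by positivity)
    (pow_le_one₀ (norm_nonneg _) hy1) hC0 (norm_nonneg (L a)) (by positivity) (by positivity) hk hu hsplit hna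
    hep hw0 hCu hlaw hE

/-! ### The verdict on "diminished by a factor (1 − 1/20)" for the minimal move -/

/-- **The factor `(1 − 1/20)` FAILS for THE minimal solution of (26)** whenever `Ty` is well aligned with `y`
relative to the scale `εθ`: under the hypotheses of `etheta_succ_law` with `εθ ≥ 10⁻⁷⁰` and
`|⟨y,Ty⟩|² ≥ (‖y‖² − 0.49)(1.1εθ + ‖Ty‖²)` (e.g. deep in a Case II run, `εθ ≪ ‖Ty‖²`, with
`cos²∠(y,Ty) ≥ 1 − 0.49/‖y‖²`), the next `εθ` satisfies `(εθ)' > (1 − 1/20)εθ`.  So the sentence "we get Case II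
and pass to a smaller `εθ`, diminished by a factor `(1 − 1/20)`" does not hold for the actual minimal move; the
text derived it from (27), which is refuted (`eq27_false_for_minimal`). [cite: Enflo2023, v2 p.13, tex L421–L431] -/
theorem factor_false_for_minimal (T : H →L[ℂ] H) (hT1 : ‖T‖ < 1) (hT : ‖T‖ ≤ 1 / 10 ^ 20)
    (x₀ y : H) (et : ℝ) (a : ℓ2)
    (h0 : ‖x₀‖ = 1) (ht : ⟪x₀ - y, y⟫_ℂ = et) (het0 : 1 / 10 ^ 70 ≤ et) (het1 : et ≤ 1 / 10 ^ 4)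
    (hd : ‖x₀ - y‖ ≤ 0.7) (hII : ∀ j, 1 ≤ j → ⟪x₀ - y, (T ^ j) y⟫_ℂ = 0)
    (hmin : IsMinimal (V T hT1 y) x₀ ‖x₀ - ((1 + et / 10 : ℝ) : ℂ) • y‖ a)
    (halign : (‖y‖ ^ 2 - 49 / 100) * (11 / 10 * et + ‖T y‖ ^ 2) ≤ ‖⟪y, T y⟫_ℂ‖ ^ 2) :
    (1 - 1 / 20) * et < (⟪x₀ - V T hT1 y a, V T hT1 y a⟫_ℂ).re := by
  have het0' : 1 / 10 ^ 78 ≤ et := le_trans (by norm_num) het0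
  have hpos : 0 < et := lt_of_lt_of_le (by norm_num) het0
  obtain ⟨hL, -⟩ := etheta_succ_law T hT1 hT x₀ y et a h0 ht het0' het1 hd hII hmin
  have hD : 0 < 11 / 10 * et + ‖T y‖ ^ 2 := by positivity
  have hS : ‖y‖ ^ 2 - ‖⟪y, T y⟫_ℂ‖ ^ 2 / (11 / 10 * et + ‖T y‖ ^ 2) ≤ 49 / 100 := by
    rw [sub_le_comm, le_div_iff₀ hD]; exact halign
  have hr0 : 0 ≤ Real.sqrt et := Real.sqrt_nonneg _
  have hr2 : Real.sqrt et ^ 2 = et := Real.sq_sqrt hpos.le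
  have hr35 : 1 / 10 ^ 35 ≤ Real.sqrt et := by
    rw [show (1 / 10 ^ 35 : ℝ) = Real.sqrt ((1 / 10 ^ 35) ^ 2) by rw [Real.sqrt_sq (by norm_num)]]
    exact Real.sqrt_le_sqrt (by linarith [het0])
  have h1 := mul_le_mul_of_nonneg_left hS (by positivity : (0 : ℝ) ≤ et / 10)
  nlinarith [mul_nonneg hr0 (sub_nonneg.2 hr35)]

/-- The same, as the negation of the text's displayed inequality `⟨ℓ'(T)y₁', x₀ − ℓ'(T)y₁'⟩ < εθ(1 − 1/20)` for
the minimal solution `ℓ'` of (26). [cite: Enflo2023, v2 p.13, tex L421–L425] -/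
theorem not_factor_for_minimal (T : H →L[ℂ] H) (hT1 : ‖T‖ < 1) (hT : ‖T‖ ≤ 1 / 10 ^ 20)
    (x₀ y : H) (et : ℝ) (a : ℓ2)
    (h0 : ‖x₀‖ = 1) (ht : ⟪x₀ - y, y⟫_ℂ = et) (het0 : 1 / 10 ^ 70 ≤ et) (het1 : et ≤ 1 / 10 ^ 4)
    (hd : ‖x₀ - y‖ ≤ 0.7) (hII : ∀ j, 1 ≤ j → ⟪x₀ - y, (T ^ j) y⟫_ℂ = 0)
    (hmin : IsMinimal (V T hT1 y) x₀ ‖x₀ - ((1 + et / 10 : ℝ) : ℂ) • y‖ a)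
    (halign : (‖y‖ ^ 2 - 49 / 100) * (11 / 10 * et + ‖T y‖ ^ 2) ≤ ‖⟪y, T y⟫_ℂ‖ ^ 2) :
    ¬ ((⟪x₀ - V T hT1 y a, V T hT1 y a⟫_ℂ).re < (1 - 1 / 20) * et) :=
  not_lt.2 (factor_false_for_minimal T hT1 hT x₀ y et a h0 ht het0 het1 hd hII hmin halign).le

/-- **… and it HOLDS when `y` is far from the direction of `Ty`**: under the hypotheses of `etheta_succ_law` with
`εθ ≥ 10⁻⁷⁰` and `‖y‖² − |⟨y,Ty⟩|²/‖Ty‖² ≥ 3/5` (i.e. `‖y‖² sin²∠(y,Ty) ≥ 3/5`), `(εθ)' ≤ (1 − 1/20)εθ`.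
Together with `factor_false_for_minimal`: for the minimal solution of (26) the text's factor is a statement about
the ANGLE between `y` and `Ty` (deep in a run), which nothing on pp.12–13 controls. [cite: Enflo2023, v2 p.13, tex L421–L431] -/
theorem factor_of_large_angle (T : H →L[ℂ] H) (hT1 : ‖T‖ < 1) (hT : ‖T‖ ≤ 1 / 10 ^ 20)
    (x₀ y : H) (et : ℝ) (a : ℓ2)
    (h0 : ‖x₀‖ = 1) (ht : ⟪x₀ - y, y⟫_ℂ = et) (het0 : 1 / 10 ^ 70 ≤ et) (het1 : et ≤ 1 / 10 ^ 4)
    (hd : ‖x₀ - y‖ ≤ 0.7) (hII : ∀ j, 1 ≤ j → ⟪x₀ - y, (T ^ j) y⟫_ℂ = 0)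
    (hmin : IsMinimal (V T hT1 y) x₀ ‖x₀ - ((1 + et / 10 : ℝ) : ℂ) • y‖ a)
    (hperp : 3 / 5 ≤ ‖y‖ ^ 2 - ‖⟪y, T y⟫_ℂ‖ ^ 2 / ‖T y‖ ^ 2) :
    (⟪x₀ - V T hT1 y a, V T hT1 y a⟫_ℂ).re ≤ (1 - 1 / 20) * et := by
  have het0' : 1 / 10 ^ 78 ≤ et := le_trans (by norm_num) het0
  have hpos : 0 < et := lt_of_lt_of_le (by norm_num) het0
  obtain ⟨-, hU⟩ := etheta_succ_law T hT1 hT x₀ y et a h0 ht het0' het1 hd hII hmin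
  have hr0 : 0 ≤ Real.sqrt et := Real.sqrt_nonneg _
  have hr2 : Real.sqrt et ^ 2 = et := Real.sq_sqrt hpos.le
  have hr35 : 1 / 10 ^ 35 ≤ Real.sqrt et := by
    rw [show (1 / 10 ^ 35 : ℝ) = Real.sqrt ((1 / 10 ^ 35) ^ 2) by rw [Real.sqrt_sq (by norm_num)]]
    exact Real.sqrt_le_sqrt (by linarith [het0])
  have h6 : (1 + et / 10) ^ 2 ≤ 1 + et / 4 := by nlinarith
  have h7 : (1 + et / 10) ^ 2 * et * (1 - 19 / 200 * (‖y‖ ^ 2 - ‖⟪y, T y⟫_ℂ‖ ^ 2 / ‖T y‖ ^ 2))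
      ≤ (1 + et / 4) * et * (1 - 19 / 200 * (3 / 5)) := by
    have hb : 1 - 19 / 200 * (‖y‖ ^ 2 - ‖⟪y, T y⟫_ℂ‖ ^ 2 / ‖T y‖ ^ 2) ≤ 1 - 19 / 200 * (3 / 5) := by
      linarith
    rcases le_or_gt 0 (1 - 19 / 200 * (‖y‖ ^ 2 - ‖⟪y, T y⟫_ℂ‖ ^ 2 / ‖T y‖ ^ 2)) with hnn | hneg
    · calc (1 + et / 10) ^ 2 * et * (1 - 19 / 200 * (‖y‖ ^ 2 - ‖⟪y, T y⟫_ℂ‖ ^ 2 / ‖T y‖ ^ 2))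
          ≤ (1 + et / 4) * et * (1 - 19 / 200 * (‖y‖ ^ 2 - ‖⟪y, T y⟫_ℂ‖ ^ 2 / ‖T y‖ ^ 2)) := by
            gcongr
        _ ≤ (1 + et / 4) * et * (1 - 19 / 200 * (3 / 5)) := by gcongr
    · have : (1 + et / 10) ^ 2 * et * (1 - 19 / 200 * (‖y‖ ^ 2 - ‖⟪y, T y⟫_ℂ‖ ^ 2 / ‖T y‖ ^ 2)) ≤ 0 :=
        mul_nonpos_of_nonneg_of_nonpos (by positivity) hneg.le
      have : (0 : ℝ) ≤ (1 + et / 4) * et * (1 - 19 / 200 * (3 / 5)) := by positivity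
      linarith
  have h8 : et * et ≤ et * (1 / 10 ^ 4) := mul_le_mul_of_nonneg_left het1 hpos.le
  nlinarith [mul_nonneg hr0 (sub_nonneg.2 hr35)]

end CaseII

end General

/-! ### Non-vacuity: a `ℂ³` model where the factor fails for THE minimal solution of (26)

`y = (5/7)e₀`, `Ty = w = 10⁻²¹(e₀ + e₁)`, `T x = ‖y‖⁻²⟨y, x⟩w` (rank one, `‖T‖ ≤ 10⁻²⁰`, `T w ∈ ℂw`),
`x₀ = y + (7/5)εθ·e₀ − (7/5)εθ·e₁ + ζ e₂` with `εθ = 10⁻⁵⁰` and `ζ² = 24/49 − 2εθ − (98/25)(εθ)²`: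
then `‖x₀‖ = 1`, `⟨x₀ − y, y⟩ = εθ`, `⟨x₀ − y, T^j y⟩ = 0` for all `j ≥ 1` EXACTLY, `‖x₀ − y‖² = 24/49 − 2εθ`,
and `|⟨y,Ty⟩|² = (25/49)10⁻⁴² ≥ (‖y‖² − 0.49)(1.1εθ + ‖Ty‖²) ≈ 4·10⁻⁴⁴`. -/

section Model

variable {H : Type*} [NormedAddCommGroup H] [InnerProductSpace ℂ H]

namespace CaseII

namespace FactorModel

/-- `εθ = 10⁻⁵⁰` (deep in a run: `εθ ≪ ‖Ty‖² = 2·10⁻⁴²`). [cite: Enflo2023, v2 p.13, tex L421–L431] -/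
def etF : ℝ := 1 / 10 ^ 50
/-- `λ = 10⁻²¹`, the size of `Ty`. [cite: Enflo2023, v2 p.13, tex L421–L431] -/
def lam : ℝ := 1 / 10 ^ 21
/-- `ζ² = 24/49 − 2εθ − (98/25)(εθ)²`, the `e₂`-mass making `‖x₀‖ = 1`. [cite: Enflo2023, v2 p.13, tex L421–L431] -/
def z2 : ℝ := 24 / 49 - 2 * etF - 98 / 25 * etF ^ 2
/-- `ζ = √(ζ²)`. [cite: Enflo2023, v2 p.13, tex L421–L431] -/
def zeta : ℝ := Real.sqrt z2

/-- `εθ` unfolded. [cite: Enflo2023, v2 p.13, tex L421–L431] -/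
lemma etF_def : etF = 1 / 10 ^ 50 := rfl
/-- `λ` unfolded. [cite: Enflo2023, v2 p.13, tex L421–L431] -/
lemma lam_def : lam = 1 / 10 ^ 21 := rfl
/-- `ζ²` unfolded. [cite: Enflo2023, v2 p.13, tex L421–L431] -/
lemma z2_def : z2 = 24 / 49 - 2 * (1 / 10 ^ 50) - 98 / 25 * (1 / 10 ^ 50) ^ 2 := rfl
/-- `ζ² > 0`. [cite: Enflo2023, v2 p.13, tex L421–L431] -/
lemma z2_pos : 0 < z2 := by rw [z2_def]; norm_num
/-- `ζ² = z2`. [cite: Enflo2023, v2 p.13, tex L421–L431] -/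
lemma zeta_sq : zeta ^ 2 = z2 := Real.sq_sqrt z2_pos.le

variable (e : Fin 3 → H)

/-- `y = (5/7) e₀`. [cite: Enflo2023, v2 p.13, tex L421–L431] -/
def yF : H := ((5 / 7 : ℝ) : ℂ) • e 0
/-- `w = λ(e₀ + e₁)` (`= Ty`). [cite: Enflo2023, v2 p.13, tex L421–L431] -/
def wF : H := ((lam : ℝ) : ℂ) • e 0 + ((lam : ℝ) : ℂ) • e 1
/-- `x₀ − y = (7/5)εθ e₀ − (7/5)εθ e₁ + ζ e₂` (orthogonal to `w`, `⟨·, y⟩ = εθ`). [cite: Enflo2023, v2 p.13, tex L421–L431] -/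
def uF : H := ((7 / 5 * etF : ℝ) : ℂ) • e 0 - ((7 / 5 * etF : ℝ) : ℂ) • e 1 + ((zeta : ℝ) : ℂ) • e 2
/-- `x₀ = y + (x₀ − y)`. [cite: Enflo2023, v2 p.13, tex L421–L431] -/
def x0F : H := yF e + uF e

/-- The rank-one operator `T x = ‖y‖⁻² ⟪y, x⟫ w` (so `Ty = w`, `Tw ∈ ℂw`). [cite: Enflo2023, v2 p.13, tex L421–L431] -/
def TF : H →L[ℂ] H :=
  ((1 / ‖yF e‖ ^ 2 : ℝ) : ℂ) • (innerSL ℂ (yF e)).smulRight (wF e)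

/-- Unfolding `T x = ‖y‖⁻² ⟪y, x⟫ w`. [cite: Enflo2023, v2 p.13, tex L421–L431] -/
lemma TF_apply (x : H) : TF e x = ((1 / ‖yF e‖ ^ 2 : ℝ) : ℂ) • (⟪yF e, x⟫_ℂ • wF e) := by
  simp [TF, ContinuousLinearMap.smulRight_apply]

/-- `x₀ − y = uF`. [cite: Enflo2023, v2 p.13, tex L421–L431] -/
lemma x0F_sub_yF : x0F e - yF e = uF e := by simp [x0F]

variable {e}

section inner
variable (he : Orthonormal ℂ e)
include he

/-- `⟪y, y⟫ = 25/49`. [cite: Enflo2023, v2 p.13, tex L421–L431] -/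
lemma inner_yF_yF : ⟪yF e, yF e⟫_ℂ = (((5 / 7) ^ 2 : ℝ) : ℂ) := by
  simp only [yF, inner_smul_left, inner_smul_right, WindowModel.inner_e he, Complex.conj_ofReal]
  simp; ring

/-- `‖y‖² = 25/49`. [cite: Enflo2023, v2 p.13, tex L421–L431] -/
lemma norm_sq_yF : ‖yF e‖ ^ 2 = (5 / 7) ^ 2 := WindowModel.norm_sq_of_inner _ _ (inner_yF_yF he)

/-- `⟪y, w⟫ = (5/7)λ` (`= κ`). [cite: Enflo2023, v2 p.13, tex L421–L431] -/
lemma inner_yF_wF : ⟪yF e, wF e⟫_ℂ = ((5 / 7 * lam : ℝ) : ℂ) := by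
  simp only [yF, wF, inner_add_right, inner_smul_left, inner_smul_right, WindowModel.inner_e he,
    Complex.conj_ofReal]
  simp; ring

/-- `⟪w, w⟫ = 2λ²` (`= σ²`). [cite: Enflo2023, v2 p.13, tex L421–L431] -/
lemma inner_wF_wF : ⟪wF e, wF e⟫_ℂ = ((2 * lam ^ 2 : ℝ) : ℂ) := by
  simp only [wF, inner_add_left, inner_add_right, inner_smul_left, inner_smul_right, WindowModel.inner_e he,
    Complex.conj_ofReal]
  simp; ring

/-- `‖w‖² = 2λ²`. [cite: Enflo2023, v2 p.13, tex L421–L431] -/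
lemma norm_sq_wF : ‖wF e‖ ^ 2 = 2 * lam ^ 2 := WindowModel.norm_sq_of_inner _ _ (inner_wF_wF he)

/-- `⟪x₀ − y, y⟫ = (7/5)εθ·(5/7) = εθ`. [cite: Enflo2023, v2 p.13, tex L421–L431; v2 p.4, eq. (8)] -/
lemma inner_uF_yF : ⟪uF e, yF e⟫_ℂ = ((etF : ℝ) : ℂ) := by
  simp only [uF, yF, inner_add_left, inner_sub_left, inner_smul_left, inner_smul_right, WindowModel.inner_e he,
    Complex.conj_ofReal]
  simp; ring

/-- `⟪x₀ − y, w⟫ = λ((7/5)εθ − (7/5)εθ) = 0`: Case II exactly at `j = 1`. [cite: Enflo2023, v2 p.12, Case II] -/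
lemma inner_uF_wF : ⟪uF e, wF e⟫_ℂ = 0 := by
  simp only [uF, wF, inner_add_left, inner_sub_left, inner_add_right, inner_smul_left, inner_smul_right,
    WindowModel.inner_e he, Complex.conj_ofReal]
  simp

/-- `⟪x₀ − y, x₀ − y⟫ = 2(7εθ/5)² + ζ²`. [cite: Enflo2023, v2 p.13, tex L421–L431] -/
lemma inner_uF_uF : ⟪uF e, uF e⟫_ℂ = ((2 * (7 / 5 * etF) ^ 2 + zeta ^ 2 : ℝ) : ℂ) := by
  simp only [uF, inner_add_left, inner_add_right, inner_sub_left, inner_sub_right, inner_smul_left,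
    inner_smul_right, WindowModel.inner_e he, Complex.conj_ofReal]
  simp; ring

/-- (8) on the model: `⟪x₀ − y, y⟫ = εθ`. [cite: Enflo2023, v2 p.4, eq. (8)] -/
lemma inner_x0F_sub_yF : ⟪x0F e - yF e, yF e⟫_ℂ = ((etF : ℝ) : ℂ) := by rw [x0F_sub_yF, inner_uF_yF he]

/-- `⟪x₀ − y, w⟫ = 0`. [cite: Enflo2023, v2 p.12, Case II] -/
lemma inner_x0F_sub_wF : ⟪x0F e - yF e, wF e⟫_ℂ = 0 := by rw [x0F_sub_yF, inner_uF_wF he]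

/-- `‖x₀ − y‖² = 24/49 − 2εθ`. [cite: Enflo2023, v2 p.13, tex L421–L431] -/
lemma norm_sq_x0F_sub : ‖x0F e - yF e‖ ^ 2 = 24 / 49 - 2 * etF := by
  rw [x0F_sub_yF, WindowModel.norm_sq_of_inner _ _ (inner_uF_uF he), zeta_sq, z2]; ring

/-- `‖x₀ − y‖ ≤ 0.7`. [cite: Enflo2023, v2 p.13, tex L421–L431] -/
lemma norm_x0F_sub_le : ‖x0F e - yF e‖ ≤ 0.7 :=
  (pow_le_pow_iff_left₀ (norm_nonneg _) (by norm_num) two_ne_zero).1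
    (by rw [norm_sq_x0F_sub he, etF_def]; norm_num)

/-- `‖x₀‖ = 1`. [cite: Enflo2023, v2 p.1] -/
lemma norm_x0F : ‖x0F e‖ = 1 := by
  have h : ⟪x0F e, x0F e⟫_ℂ = ((1 : ℝ) : ℂ) := by
    rw [x0F, inner_add_left, inner_add_right, inner_add_right, inner_yF_yF he, inner_uF_uF he, inner_uF_yF he,
      ← inner_conj_symm (yF e) (uF e), inner_uF_yF he, Complex.conj_ofReal, zeta_sq, z2]
    push_cast; ring
  have h1 : ‖x0F e‖ ^ 2 = 1 ^ 2 := by rw [WindowModel.norm_sq_of_inner _ _ h, one_pow]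
  exact (pow_left_inj₀ (norm_nonneg _) zero_le_one two_ne_zero).1 h1

/-- `Ty = w`. [cite: Enflo2023, v2 p.13, tex L421–L431] -/
lemma TF_yF : TF e (yF e) = wF e := by
  have hy2 : ‖yF e‖ ^ 2 ≠ 0 := by rw [norm_sq_yF he]; norm_num
  rw [TF_apply, inner_self_eq_coe_norm_sq, smul_smul, ← Complex.ofReal_mul, one_div,
    inv_mul_cancel₀ hy2, Complex.ofReal_one, one_smul]

/-- `Tw = (7λ/5) w`: `w` is an eigenvector, so the orbit `T^j y`, `j ≥ 1`, stays on the line `ℂw`.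
[cite: Enflo2023, v2 p.13, tex L421–L431] -/
lemma TF_wF : TF e (wF e) = ((7 / 5 * lam : ℝ) : ℂ) • wF e := by
  rw [TF_apply, inner_yF_wF he, norm_sq_yF he, smul_smul]
  congr 1
  push_cast; ring

/-- `T^{j+1} y = (7λ/5)^j w`. [cite: Enflo2023, v2 p.13, tex L421–L431] -/
lemma TF_pow_yF (j : ℕ) : (TF e ^ (j + 1)) (yF e) = ((((7 / 5 * lam) ^ j : ℝ)) : ℂ) • wF e := by
  induction j with
  | zero => simp [TF_yF he]
  | succ j ih =>
      rw [pow_succ', mul_apply_eq_comp, ih, map_smul, TF_wF he, smul_smul]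
      congr 1
      push_cast; ring

/-- **Case II holds EXACTLY on the model**: `⟨x₀ − y, T^j y⟩ = 0` for every `j ≥ 1`. [cite: Enflo2023, v2 p.12, Case II] -/
lemma caseII_exact (j : ℕ) (hj : 1 ≤ j) : ⟪x0F e - yF e, (TF e ^ j) (yF e)⟫_ℂ = 0 := by
  obtain ⟨i, rfl⟩ := Nat.exists_eq_add_of_le' hj
  rw [TF_pow_yF he, inner_smul_right, inner_x0F_sub_wF he, mul_zero]

/-- `‖T‖ ≤ 10⁻²⁰` (`‖T‖ ≤ ‖w‖/‖y‖ = √2·10⁻²¹·7/5`). [cite: Enflo2023, v2 p.1, `‖T‖ = 10⁻²⁰`] -/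
lemma norm_TF_le : ‖TF e‖ ≤ 1 / 10 ^ 20 := by
  have hy2 := norm_sq_yF he
  have hw2 := norm_sq_wF he
  have hwle : ‖wF e‖ ≤ 3 / 10 ^ 21 := by
    have : ‖wF e‖ ^ 2 ≤ (3 / 10 ^ 21) ^ 2 := by rw [hw2, lam_def]; norm_num
    exact (pow_le_pow_iff_left₀ (norm_nonneg _) (by norm_num) two_ne_zero).1 this
  have hyge : 0.7 ≤ ‖yF e‖ := by
    have : (0.7 : ℝ) ^ 2 ≤ ‖yF e‖ ^ 2 := by rw [hy2]; norm_num
    exact (pow_le_pow_iff_left₀ (by norm_num) (norm_nonneg _) two_ne_zero).1 this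
  have hy0 : 0 < ‖yF e‖ := lt_of_lt_of_le (by norm_num) hyge
  refine ContinuousLinearMap.opNorm_le_bound _ (by norm_num) (fun x => ?_)
  rw [TF_apply, norm_smul, norm_smul, Complex.norm_real, Real.norm_of_nonneg (by positivity)]
  have hcs : ‖⟪yF e, x⟫_ℂ‖ ≤ ‖yF e‖ * ‖x‖ := norm_inner_le_norm (𝕜 := ℂ) _ _
  calc 1 / ‖yF e‖ ^ 2 * (‖⟪yF e, x⟫_ℂ‖ * ‖wF e‖) ≤ 1 / ‖yF e‖ ^ 2 * ((‖yF e‖ * ‖x‖) * (3 / 10 ^ 21)) := by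
        gcongr
    _ = (3 / 10 ^ 21 / ‖yF e‖) * ‖x‖ := by field_simp
    _ ≤ (3 / 10 ^ 21 / 0.7) * ‖x‖ := by gcongr
    _ ≤ 1 / 10 ^ 20 * ‖x‖ := mul_le_mul_of_nonneg_right (by norm_num) (norm_nonneg x)

/-- `‖T‖ < 1`. [cite: Enflo2023, v2 p.1] -/
lemma norm_TF_lt_one : ‖TF e‖ < 1 := (norm_TF_le he).trans_lt (by norm_num)

/-- **The alignment hypothesis holds**: `(‖y‖² − 0.49)(1.1εθ + ‖Ty‖²) ≤ |⟨y, Ty⟩|²`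
(`99/4900 · (1.1·10⁻⁵⁰ + 2·10⁻⁴²) ≈ 4·10⁻⁴⁴ ≤ (25/49)·10⁻⁴²`). [cite: Enflo2023, v2 p.13, tex L421–L431] -/
lemma align : (‖yF e‖ ^ 2 - 49 / 100) * (11 / 10 * etF + ‖TF e (yF e)‖ ^ 2) ≤ ‖⟪yF e, TF e (yF e)⟫_ℂ‖ ^ 2 := by
  rw [TF_yF he, norm_sq_yF he, norm_sq_wF he, inner_yF_wF he, Complex.norm_real,
    Real.norm_of_nonneg (by rw [lam_def]; norm_num), etF_def, lam_def]
  norm_num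

variable [CompleteSpace H]

/-- **Every hypothesis of `factor_false_for_minimal` holds on the model, for SOME `a ∈ ℓ²`** — the minimal solution
of (26) for `T = TF`, which exists since `(1+δ)e₀` is feasible and `ℓ²` is complete. [cite: Enflo2023, v2 p.13, eq. (26)] -/
theorem hypotheses :
    ∃ a : Vy.ℓ2,
      ‖TF e‖ ≤ 1 / 10 ^ 20 ∧ ‖x0F e‖ = 1 ∧ ⟪x0F e - yF e, yF e⟫_ℂ = ((etF : ℝ) : ℂ) ∧
      1 / 10 ^ 70 ≤ etF ∧ etF ≤ 1 / 10 ^ 4 ∧ ‖x0F e - yF e‖ ≤ 0.7 ∧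
      (∀ j, 1 ≤ j → ⟪x0F e - yF e, (TF e ^ j) (yF e)⟫_ℂ = 0) ∧
      IsMinimal (Vy.V (TF e) (norm_TF_lt_one he) (yF e)) (x0F e) ‖x0F e - ((1 + etF / 10 : ℝ) : ℂ) • yF e‖ a ∧
      (‖yF e‖ ^ 2 - 49 / 100) * (11 / 10 * etF + ‖TF e (yF e)‖ ^ 2) ≤ ‖⟪yF e, TF e (yF e)⟫_ℂ‖ ^ 2 := by
  have hfeas : ((((1 + etF / 10 : ℝ) : ℂ)) • (lp.single 2 0 (1 : ℂ) : Vy.ℓ2)) ∈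
      feasible (Vy.V (TF e) (norm_TF_lt_one he) (yF e)) (x0F e) ‖x0F e - ((1 + etF / 10 : ℝ) : ℂ) • yF e‖ := by
    rw [mem_feasible, Vy.V_smul_single_zero]
  obtain ⟨a, ha⟩ := exists_isMinimal _ _ _ ⟨_, hfeas⟩
  exact ⟨a, norm_TF_le he, norm_x0F he, inner_x0F_sub_yF he, by rw [etF_def]; norm_num, by rw [etF_def]; norm_num,
    norm_x0F_sub_le he, caseII_exact he, ha, align he⟩

/-- **The refutation FIRES**: for `T = TF` and THE minimal solution `a` of (26), the next `εθ` is
`> (1 − 1/20)εθ` (applying `factor_false_for_minimal`, which is therefore not vacuous). [cite: Enflo2023, v2 p.13, tex L421–L431] -/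
theorem factor_false_fires :
    ∃ a : Vy.ℓ2,
      IsMinimal (Vy.V (TF e) (norm_TF_lt_one he) (yF e)) (x0F e) ‖x0F e - ((1 + etF / 10 : ℝ) : ℂ) • yF e‖ a ∧
      (1 - 1 / 20) * etF
        < (⟪x0F e - Vy.V (TF e) (norm_TF_lt_one he) (yF e) a, Vy.V (TF e) (norm_TF_lt_one he) (yF e) a⟫_ℂ).re := by
  obtain ⟨a, hT, h0, hey, het0, het1, hd, hII, ha, hal⟩ := hypotheses he
  exact ⟨a, ha, factor_false_for_minimal (TF e) (norm_TF_lt_one he) hT (x0F e) (yF e) etF a h0 hey het0 het1 hd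
    hII ha hal⟩

end inner

end FactorModel

/-- **Satisfiability in `ℂ³` with a genuine operator and its genuine minimiser**: a bounded `T` with
`‖T‖ ≤ 10⁻²⁰`, `‖x₀‖ = 1`, `⟨x₀ − y, y⟩ = εθ ∈ [10⁻⁷⁰, 10⁻⁴]`, `‖x₀ − y‖ ≤ 0.7`, Case II EXACT for all `j ≥ 1`,
THE minimal solution `a` of (26), the alignment hypothesis — and `(εθ)' > (1 − 1/20)εθ`. [cite: Enflo2023, v2 p.13, tex L421–L431] -/
theorem factor_false_satisfiable :
    ∃ (T : EuclideanSpace ℂ (Fin 3) →L[ℂ] EuclideanSpace ℂ (Fin 3)) (hT1 : ‖T‖ < 1)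
      (x₀ y : EuclideanSpace ℂ (Fin 3)) (et : ℝ) (a : Vy.ℓ2),
      ‖T‖ ≤ 1 / 10 ^ 20 ∧ ‖x₀‖ = 1 ∧ ⟪x₀ - y, y⟫_ℂ = (et : ℂ) ∧ 1 / 10 ^ 70 ≤ et ∧ et ≤ 1 / 10 ^ 4 ∧
      ‖x₀ - y‖ ≤ 0.7 ∧ (∀ j, 1 ≤ j → ⟪x₀ - y, (T ^ j) y⟫_ℂ = 0) ∧
      IsMinimal (Vy.V T hT1 y) x₀ ‖x₀ - ((1 + et / 10 : ℝ) : ℂ) • y‖ a ∧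
      (‖y‖ ^ 2 - 49 / 100) * (11 / 10 * et + ‖T y‖ ^ 2) ≤ ‖⟪y, T y⟫_ℂ‖ ^ 2 ∧
      (1 - 1 / 20) * et < (⟪x₀ - Vy.V T hT1 y a, Vy.V T hT1 y a⟫_ℂ).re := by
  let e : Fin 3 → EuclideanSpace ℂ (Fin 3) := fun i => EuclideanSpace.basisFun (Fin 3) ℂ i
  have he : Orthonormal ℂ e := (EuclideanSpace.basisFun (Fin 3) ℂ).orthonormal
  obtain ⟨a, hT, h0, hey, het0, het1, hd, hII, ha, hal⟩ := FactorModel.hypotheses he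
  exact ⟨FactorModel.TF e, FactorModel.norm_TF_lt_one he, FactorModel.x0F e, FactorModel.yF e, FactorModel.etF, a,
    hT, h0, hey, het0, het1, hd, hII, ha, hal,
    factor_false_for_minimal _ _ hT _ _ _ a h0 hey het0 het1 hd hII ha hal⟩

end CaseII

end Model

end Literature.Analysis.OperatorTheory.Enflo2023

end
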